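import Mathlib.Algebra.Polynomial.Splits
import Mathlib.Algebra.Polynomial.Div
import Mathlib.Algebra.Polynomial.Derivative
import Mathlib.Analysis.Calculus.Deriv.Polynomial
import Mathlib.FieldTheory.AlgebraicClosure

/-!
# `NormalFormPrinciple` (stmt-KontsevichZagierPeriods-3869) — siege of the registered stub
# `box_algsplit_mem_relations` (attempt k4), I: partial fractions over a real field of constants

Pure algebra, no KZ calculus. For the stub `box_algsplit_mem_relations` (BoxVanishing in dimension
one for `[(0,1), p/q]`, `p, q ∈ ℚ[X]`, all complex roots of `q` real) the finite core of the proof is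
a certificate: the partial-fraction expansion of `p/q` over the field `K` generated by the (real
algebraic) poles, split into

* a polynomial part `G ∈ K[X]`,
* the SIMPLE poles `Σᵢ cᵢ/(t − ρᵢ)` (they integrate to logarithms), and
* the HIGHER poles `Σᵢ c'ᵢ/(t − ρ'ᵢ)^{j'ᵢ+2}` (they, like `G`, have a `K`-rational primitive),

valid as an identity of real functions wherever `q ≠ 0` (`exists_partialFraction`, by peeling one
pole at a time, `exists_peel_poleK`, and strong induction on `deg q`), together with polynomial
primitives over `K` (`exists_polynomial_hasDerivAt`). Everything is stated for an arbitrary field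
`K` with an algebra map to `ℝ`; the stub uses `K = algebraicClosure ℚ ℝ`.

Sources: folklore (partial fractions); M. Kontsevich, D. Zagier, *Periods* (2001), §1.2 for the
use. No definitions are introduced.
-/

noncomputable section

open Finset
open scoped Polynomial

namespace Summit.KontsevichZagierPeriods.HurwitzMicroSectors.NormalFormPrinciple.BoxAlgSplitK4

/-! ## One peeling step -/

/-- **Peeling a pole over `K`.** If `q(ρ) = 0` (`ρ ∈ K`, `q ≠ 0`) then, as real functions wherever
`q(t) ≠ 0`, `p/q = c/(t − ρ)^{k+1} + p₁/q₁` with `k + 1` the multiplicity of `ρ`, `c ∈ K`, and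
`q₁ ∈ K[X]` a non-zero proper divisor of `q`. [folklore] -/
theorem exists_peel_poleK {K : Type*} [Field K] [Algebra K ℝ] (p q : K[X]) (hq : q ≠ 0) {ρ : K}
    (hρ : q.IsRoot ρ) :
    ∃ (k : ℕ) (c : K) (p₁ q₁ : K[X]), q₁ ≠ 0 ∧ q₁.natDegree < q.natDegree ∧ q₁ ∣ q ∧
      ∀ t : ℝ, (Polynomial.aeval t q : ℝ) ≠ 0 →
        (Polynomial.aeval t p : ℝ) / Polynomial.aeval t q =
          algebraMap K ℝ c / (t - algebraMap K ℝ ρ) ^ (k + 1) +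
            (Polynomial.aeval t p₁ : ℝ) / Polynomial.aeval t q₁ := by
  -- adapted from `PiBox.Dlog.exists_peel_pole` (the case `K = ℚ`)
  obtain ⟨q₂, hq₂, hndvd⟩ := q.exists_eq_pow_rootMultiplicity_mul_and_not_dvd hq ρ
  have hm : 0 < q.rootMultiplicity ρ := (Polynomial.rootMultiplicity_pos hq).mpr hρ
  obtain ⟨k, hk⟩ : ∃ k, q.rootMultiplicity ρ = k + 1 := Nat.exists_eq_succ_of_ne_zero hm.ne'
  have hq₂ρ : q₂.eval ρ ≠ 0 := fun h => hndvd (Polynomial.dvd_iff_isRoot.mpr h)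
  have hq₂0 : q₂ ≠ 0 := by
    rintro rfl
    simp at hq₂ρ
  set c : K := p.eval ρ / q₂.eval ρ with hc
  have hroot : (p - Polynomial.C c * q₂).IsRoot ρ := by
    rw [Polynomial.IsRoot.def, Polynomial.eval_sub, Polynomial.eval_mul, Polynomial.eval_C, hc,
      div_mul_cancel₀ _ hq₂ρ, sub_self]
  set p₁ : K[X] := (p - Polynomial.C c * q₂) /ₘ (Polynomial.X - Polynomial.C ρ) with hp₁
  have hp₁' : (Polynomial.X - Polynomial.C ρ) * p₁ = p - Polynomial.C c * q₂ :=
    Polynomial.mul_divByMonic_eq_iff_isRoot.mpr hroot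
  set q₁ : K[X] := (Polynomial.X - Polynomial.C ρ) ^ k * q₂ with hq₁
  have hXne : (Polynomial.X - Polynomial.C ρ : K[X]) ≠ 0 := Polynomial.X_sub_C_ne_zero ρ
  refine ⟨k, c, p₁, q₁, mul_ne_zero (pow_ne_zero _ hXne) hq₂0, ?_, ?_, ?_⟩
  · have hdeg : q.natDegree = (k + 1) + q₂.natDegree := by
      conv_lhs => rw [hq₂, hk]
      rw [Polynomial.natDegree_mul (pow_ne_zero _ hXne) hq₂0, Polynomial.natDegree_pow,
        Polynomial.natDegree_X_sub_C, mul_one]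
    have hdeg₁ : q₁.natDegree = k + q₂.natDegree := by
      rw [hq₁, Polynomial.natDegree_mul (pow_ne_zero _ hXne) hq₂0, Polynomial.natDegree_pow,
        Polynomial.natDegree_X_sub_C, mul_one]
    omega
  · refine ⟨Polynomial.X - Polynomial.C ρ, ?_⟩
    conv_lhs => rw [hq₂, hk]
    rw [hq₁, pow_succ]
    ring
  · intro t ht
    have hqt : (Polynomial.aeval t q : ℝ) =
        (t - algebraMap K ℝ ρ) ^ (k + 1) * Polynomial.aeval t q₂ := by
      conv_lhs => rw [hq₂, hk]
      simp [map_mul, map_pow]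
    have hq₁t : (Polynomial.aeval t q₁ : ℝ) = (t - algebraMap K ℝ ρ) ^ k * Polynomial.aeval t q₂ := by
      rw [hq₁]
      simp [map_mul, map_pow]
    have hpt : (Polynomial.aeval t p : ℝ) =
        (t - algebraMap K ℝ ρ) * Polynomial.aeval t p₁ + algebraMap K ℝ c * Polynomial.aeval t q₂ := by
      have h := congrArg (Polynomial.aeval t) hp₁'
      simp only [map_mul, map_sub, Polynomial.aeval_X, Polynomial.aeval_C] at h
      linear_combination -h
    have htρ : t - algebraMap K ℝ ρ ≠ 0 := by
      intro h
      apply ht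
      rw [hqt, h]
      simp
    have hq₂t : (Polynomial.aeval t q₂ : ℝ) ≠ 0 := by
      intro h
      apply ht
      rw [hqt, h, mul_zero]
    rw [hqt, hq₁t, hpt]
    field_simp
    ring

/-! ## The full expansion, simple poles apart -/

/-- **Partial fractions with the simple poles separated.** For `q ≠ 0` in `K[X]` that splits over
`K`, and any `p ∈ K[X]`: as real functions wherever `q(t) ≠ 0`,
`p/q = G + Σᵢ cᵢ/(t − ρᵢ) + Σᵢ c'ᵢ/(t − ρ'ᵢ)^{j'ᵢ + 2}` with `G ∈ K[X]`, constants in `K`, and all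
the `ρᵢ, ρ'ᵢ` roots of `q`. (Strong induction on `deg q`, peeling one pole at a time.) [folklore] -/
theorem exists_partialFraction {K : Type*} [Field K] [Algebra K ℝ] (d : ℕ) (p q : K[X]) (hq : q ≠ 0)
    (hs : q.Splits) (hdeg : q.natDegree ≤ d) :
    ∃ (G : K[X]) (m : ℕ) (c ρ : Fin m → K) (m' : ℕ) (c' ρ' : Fin m' → K) (j' : Fin m' → ℕ),
      (∀ i, q.IsRoot (ρ i)) ∧ (∀ i, q.IsRoot (ρ' i)) ∧
      ∀ t : ℝ, (Polynomial.aeval t q : ℝ) ≠ 0 →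
        (Polynomial.aeval t p : ℝ) / Polynomial.aeval t q =
          Polynomial.aeval t G + ∑ i, algebraMap K ℝ (c i) / (t - algebraMap K ℝ (ρ i)) +
            ∑ i, algebraMap K ℝ (c' i) / (t - algebraMap K ℝ (ρ' i)) ^ (j' i + 2) := by
  induction d generalizing p q with
  | zero =>
    -- `q` is a non-zero constant
    obtain ⟨a, rfl⟩ : ∃ a, q = Polynomial.C a :=
      ⟨q.coeff 0, Polynomial.eq_C_of_natDegree_le_zero hdeg⟩
    have ha : a ≠ 0 := fun h => hq (by rw [h, map_zero])
    refine ⟨Polynomial.C a⁻¹ * p, 0, Fin.elim0, Fin.elim0, 0, Fin.elim0, Fin.elim0, Fin.elim0,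
      fun i => i.elim0, fun i => i.elim0, fun t _ => ?_⟩
    have ha' : algebraMap K ℝ a ≠ 0 := by
      rw [ne_eq, map_eq_zero_iff _ (algebraMap K ℝ).injective]
      exact ha
    simp only [Polynomial.aeval_C, map_mul, map_inv₀, Finset.univ_eq_empty, Finset.sum_empty,
      add_zero]
    field_simp
  | succ d ih =>
    by_cases hd : q.natDegree ≤ d
    · exact ih p q hq hs hd
    -- a root `ρ` of `q`, peeled off
    have hdeg0 : q.degree ≠ 0 := by
      rw [Polynomial.degree_eq_natDegree hq]
      exact_mod_cast (show q.natDegree ≠ 0 by omega)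
    obtain ⟨ρ, hρ⟩ := hs.exists_eval_eq_zero hdeg0
    obtain ⟨k, c, p₁, q₁, hq₁, hlt, hdvd, hpeel⟩ := exists_peel_poleK p q hq hρ
    obtain ⟨G, m, cc, ρρ, m', c', ρ', j', hρρ, hρ', hsum⟩ :=
      ih p₁ q₁ hq₁ (hs.of_dvd hq hdvd) (by omega)
    have hrootq : ∀ x, q₁.IsRoot x → q.IsRoot x := fun x hx => hx.dvd hdvd
    have hq₁t : ∀ t : ℝ, (Polynomial.aeval t q : ℝ) ≠ 0 → (Polynomial.aeval t q₁ : ℝ) ≠ 0 := by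
      intro t ht h
      obtain ⟨r, hr⟩ := hdvd
      apply ht
      rw [hr, map_mul, h, zero_mul]
    rcases k with _ | k
    · -- a simple pole: prepend `(c, ρ)` to the simple family
      refine ⟨G, m + 1, Fin.cons c cc, Fin.cons ρ ρρ, m', c', ρ', j',
        Fin.cases (by simpa using hρ) (fun i => by simpa using hrootq _ (hρρ i)),
        fun i => hrootq _ (hρ' i), fun t ht => ?_⟩
      rw [hpeel t ht, hsum t (hq₁t t ht)]
      simp only [Fin.sum_univ_succ, Fin.cons_zero, Fin.cons_succ, zero_add, pow_one]
      ring
    · -- a higher pole: prepend `(c, ρ, k)` to the higher family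
      refine ⟨G, m, cc, ρρ, m' + 1, Fin.cons c c', Fin.cons ρ ρ', Fin.cons k j',
        fun i => hrootq _ (hρρ i),
        Fin.cases (by simpa using hρ) (fun i => by simpa using hrootq _ (hρ' i)), fun t ht => ?_⟩
      rw [hpeel t ht, hsum t (hq₁t t ht)]
      simp only [Fin.sum_univ_succ, Fin.cons_zero, Fin.cons_succ]
      ring

/-! ## Polynomial primitives over `K` -/

/-- Every `A ∈ K[X]` (`char K = 0`) has a primitive `G ∈ K[X]` as a real function:
`(aeval · G)' = aeval · A`. [folklore] -/
theorem exists_polynomial_hasDerivAt {K : Type*} [Field K] [CharZero K] [Algebra K ℝ] (A : K[X]) :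
    ∃ G : K[X], ∀ t : ℝ, HasDerivAt (fun u : ℝ => (Polynomial.aeval u G : ℝ))
      (Polynomial.aeval t A) t := by
  -- adapted from `PiBox.Dlog.exists_polynomial_hasDerivAt` (the case `K = ℚ`)
  suffices h : ∃ G : K[X], Polynomial.derivative G = A by
    obtain ⟨G, hG⟩ := h
    refine ⟨G, fun t => ?_⟩
    have := Polynomial.hasDerivAt_aeval G t
    rwa [hG] at this
  induction A using Polynomial.induction_on' with
  | add p q hp hq =>
    obtain ⟨Gp, hGp⟩ := hp
    obtain ⟨Gq, hGq⟩ := hq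
    exact ⟨Gp + Gq, by rw [Polynomial.derivative_add, hGp, hGq]⟩
  | monomial n a =>
    refine ⟨Polynomial.C (a / ((n : K) + 1)) * Polynomial.X ^ (n + 1), ?_⟩
    have hn : ((n : K) + 1) ≠ 0 := by exact_mod_cast Nat.succ_ne_zero n
    rw [Polynomial.derivative_C_mul_X_pow, ← Polynomial.C_mul_X_pow_eq_monomial,
      Nat.add_sub_cancel]
    congr 2
    push_cast
    exact div_mul_cancel₀ a hn

end Summit.KontsevichZagierPeriods.HurwitzMicroSectors.NormalFormPrinciple.BoxAlgSplitK4
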